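import Summits.CriticalPhenomena.SAWScalingLimit.Theorems.SAWRenewalTightnessTubeLowerBoundBPDOfSpanHyperscalingMoments

/-!
# Sub-goal `breakPointDensity_of_spanHyperscaling` of the line `subcritical-renewal-floor`
(crux `TubeLowerBound`, stmt-CriticalPhenomena-4730), part III: span hyperscaling ⇒ break-point density

Word model of `SAWWords.lean` / `SAWWordBridges.lean`; continues parts I–II
(`…BPDOfSpanHyperscalingBreaks.lean`: break points, regrouping; `…BPDOfSpanHyperscalingMoments.lean`:
moments, Chebyshev, un-tilting); as there, tilted weights and word classes are written out in full.

HYPOTHESIS (the line's S2 `SpanHyperscaling`, def-free): for some `C`, `m₀ > 0`, every exactly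
tilted pair `(z, m)` (`0 < z ≤ x_c`, `0 < m ≤ m₀`, `Σ_{w irreducible} z^{|w|} e^{m·span(w)} = 1`) has
span moments `S₁ = Σ span·π`, `S₂ = Σ span²·π` with `S₂ ≤ (C/m) S₁`.  CONCLUSION (break-point
density, the hypothesis of `spanRenewalFloor_of_breakPointDensity`): for some `c₀ > 0` and every
`D ≥ 1` the critical mass of the family `F_D` of bridge words with span in `[D, 2D)` all of whose
break points lie at levels `< D` is `≥ c₀` (some partial sum).

PROOF.  Put `C' = max(C, 1)`, `r = 32 C'`.  SMALL SCALES `D ≤ D₀ = ⌈r / min(m₀, m₁)⌉` (`m₁` from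
S1 `stub_kestenTilt`): the straight word `E^D ∈ F_D` weighs `x_c^D ≥ x_c^{D₀}`.  LARGE SCALES: take
the tilt rate `m = r/D` and (S1) a fugacity `z ∈ (0, x_c]` with `Σ_irr π = 1`,
`π(w) = z^{|w|} e^{m·span}`; the hypothesis gives `S₂ ≤ (C' D / r) S₁`, Cauchy–Schwarz
(`BPD.sq_le_of_tsums`) `S₁² ≤ S₂`, so `1 ≤ S₁ ≤ D/32`.  With `n = ⌊(3D/2)/S₁⌋ ≥ 1` pieces
(`n S₁ ∈ (3D/2 - S₁, 3D/2]`), CHEBYSHEV on the class `Q_{n-1}` of bridge words with exactly `n`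
irreducible pieces (product weight, total mass `1`, mean `n S₁`, variance `≤ n S₂`;
`BPD.tsum_tail_le`) with `t = 3D/8`: the words of `Q_{n-1}` with `|span - n S₁| < t` have tilted mass
`≥ 1 - n S₂ / t² ≥ 1 - (3D/(2S₁)) (D S₁/32) (64/(9D²)) = 2/3`, and their spans lie in
`(35D/32, 15D/8) ⊂ [D, 2D)`.  TRANSFER (`BPD.tsum_window_le_tsum_fd`): cutting such a word at its
first break point at level `≥ D` (`BPD.exists_cut`) gives a head `w' ∈ F_D` and a tail which is empty
or a bridge word with the complementary number of pieces; `(w', tail) ↦ w' ++ tail` is injective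
(`SpanFloor.eq_of_append_eq_of_breaks`), the weight is multiplicative and each fibre has mass `≤ 1`
(`BPD.tsum_breaks_twt`), so `Σ_{F_D} π ≥ 1/2`.  UN-TILT: on `F_D`, `π(w) ≤ x_c^{|w|} e^{m·2D} =
x_c^{|w|} e^{2r}`, so `Σ_{F_D} x_c^{|w|} ≥ e^{-2r}/2` and some partial sum exceeds `e^{-2r}/4`.
Hence `c₀ = min(x_c^{D₀}, e^{-2r}/4)`.

References: H. Kesten, J. Math. Phys. 4 (1963), §4; N. Madras, G. Slade, *The Self-Avoiding Walk*
(1993), §4.2.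
-/

noncomputable section

namespace Summit.CriticalPhenomena.SAWScalingLimit.Theorems.TubeLowerBound.SubcriticalRenewalFloor

open scoped BigOperators Classical ENNReal
open Literature.Probability.LatticeModels
open Literature.Probability.RandomPlanarGeometry Literature.Probability.RandomPlanarGeometry.SAW

namespace BPD

open Finset Filter Topology Function

/-! ### Transfer to the break-point-density family -/

/-- **Transfer.** For a tilted pair with `Σ_irr π = 1` (`z > 0`) and `D ≥ 1`, the tilted mass of the
words of `Q_b` with span in `[D, 2D)` is at most the tilted mass of the family `F_D` (bridge words
with span in `[D, 2D)` and all break points at levels `< D`): cut at the first break point at level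
`≥ D` (`exists_cut`); the map `(head, tail) ↦ head ++ tail` is injective
(`SpanFloor.eq_of_append_eq_of_breaks`), the weight multiplicative, and each fibre (tails: empty,
or the class with the complementary number of pieces) has mass `≤ 1` (`tsum_breaks_twt`).
[cite: Kesten1963SAW, §4] -/
theorem tsum_window_le_tsum_fd {z m : ℝ} (hz : 0 < z)
    (h1 : ∑' w, (if IsIrrBridge w then ENNReal.ofReal (z ^ w.length * Real.exp (m * (xEnd w : ℝ))) else 0) = 1) (b : ℕ) {D : ℕ} (hD : 1 ≤ D) :
    ∑' w, (if (IsSAW w ∧ IsBridgeW w ∧ w ≠ [] ∧ ((Finset.range w.length).filter (fun j => IsBreak w j)).card = b) ∧ ((D : ℤ) ≤ xEnd w ∧ xEnd w < 2 * (D : ℤ)) then ENNReal.ofReal (z ^ w.length * Real.exp (m * (xEnd w : ℝ))) else 0)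
      ≤ ∑' w, (if IsSAW w ∧ (IsBridgeW w ∧ (D : ℤ) ≤ xEnd w ∧ xEnd w < 2 * (D : ℤ) ∧
          ∀ j, IsBreak w j → xAt w j < (D : ℤ)) then ENNReal.ofReal (z ^ w.length * Real.exp (m * (xEnd w : ℝ))) else 0) := by
  have hz0 := hz.le
  have hD' : (1 : ℤ) ≤ (D : ℤ) := by exact_mod_cast hD
  -- admissible pairs (head, tail), the family weight, the fibre weight
  set R : List Step × List Step → Prop := fun p =>
    (IsSAW p.1 ∧ IsBridgeW p.1 ∧ (D : ℤ) ≤ xEnd p.1 ∧ ∀ j, IsBreak p.1 j → xAt p.1 j < (D : ℤ)) ∧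
    ((p.2 = [] ∧ ((Finset.range p.1.length).filter (fun j => IsBreak p.1 j)).card = b) ∨
      (IsSAW p.2 ∧ IsBridgeW p.2 ∧ p.2 ≠ [] ∧ ((Finset.range p.1.length).filter (fun j => IsBreak p.1 j)).card + ((Finset.range p.2.length).filter (fun j => IsBreak p.2 j)).card + 1 = b)) ∧
    ((D : ℤ) ≤ xEnd (p.1 ++ p.2) ∧ xEnd (p.1 ++ p.2) < 2 * (D : ℤ)) with hR
  set g : List Step → ℝ≥0∞ := fun w => if IsSAW w ∧ (IsBridgeW w ∧ (D : ℤ) ≤ xEnd w ∧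
      xEnd w < 2 * (D : ℤ) ∧ ∀ j, IsBreak w j → xAt w j < (D : ℤ)) then ENNReal.ofReal (z ^ w.length * Real.exp (m * (xEnd w : ℝ))) else 0 with hg
  set fib : List Step → List Step → ℝ≥0∞ := fun w' v =>
    if (v = [] ∧ ((Finset.range w'.length).filter (fun j => IsBreak w' j)).card = b) ∨ ((IsSAW v ∧ IsBridgeW v ∧ v ≠ [] ∧ ((Finset.range v.length).filter (fun j => IsBreak v j)).card = b - ((Finset.range w'.length).filter (fun j => IsBreak w' j)).card - 1) ∧ ((Finset.range w'.length).filter (fun j => IsBreak w' j)).card < b) then ENNReal.ofReal (z ^ v.length * Real.exp (m * (xEnd v : ℝ))) else 0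
    with hfib
  -- admissible pairs concatenate into `Q_b`, and their tails are bridges
  have hRbr : ∀ p, R p → IsBridgeW p.2 := by
    rintro ⟨w', v⟩ ⟨-, hv, -⟩
    rcases hv with ⟨hv, -⟩ | ⟨-, hbv, -, -⟩
    · rw [hv]
      exact isBridgeW_nil
    · exact hbv
  have hRpc : ∀ p, R p → (IsSAW (p.1 ++ p.2) ∧ IsBridgeW (p.1 ++ p.2) ∧ p.1 ++ p.2 ≠ [] ∧ ((Finset.range (p.1 ++ p.2).length).filter (fun j => IsBreak (p.1 ++ p.2) j)).card = b) := by
    rintro ⟨w', v⟩ ⟨⟨hs, hb, hDw, -⟩, hv, -⟩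
    have hne : w' ≠ [] := by
      rintro rfl
      simp [xEnd] at hDw
      omega
    rcases hv with ⟨hv, hcount⟩ | ⟨hsv, hbv, hvne, hcount⟩
    · rw [hv]
      simpa only [List.append_nil] using (⟨hs, hb, hne, hcount⟩ : (IsSAW w' ∧ IsBridgeW w' ∧ w' ≠ [] ∧ ((Finset.range w'.length).filter (fun j => IsBreak w' j)).card = b))
    · have h := breaks_append ⟨hs, hb, hne, rfl⟩ ⟨hsv, hbv, hvne, rfl⟩
      exact ⟨h.1, h.2.1, h.2.2.1, h.2.2.2.trans hcount⟩
  -- step 1: re-index the window sum over admissible pairs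
  have step1 : ∑' w, (if (IsSAW w ∧ IsBridgeW w ∧ w ≠ [] ∧ ((Finset.range w.length).filter (fun j => IsBreak w j)).card = b) ∧ ((D : ℤ) ≤ xEnd w ∧ xEnd w < 2 * (D : ℤ)) then ENNReal.ofReal (z ^ w.length * Real.exp (m * (xEnd w : ℝ))) else 0)
      = ∑' p : List Step × List Step, (if R p then ENNReal.ofReal (z ^ (p.1 ++ p.2).length * Real.exp (m * (xEnd (p.1 ++ p.2) : ℝ))) else 0) := by
    refine tsum_eq_tsum_of_ne_zero_bij
      (fun p : support (fun p : List Step × List Step => if R p then ENNReal.ofReal (z ^ (p.1 ++ p.2).length * Real.exp (m * (xEnd (p.1 ++ p.2) : ℝ))) else 0) =>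
        p.1.1 ++ p.1.2) ?_ ?_ ?_
    · rintro ⟨⟨w₁, v₁⟩, h₁⟩ ⟨⟨w₂, v₂⟩, h₂⟩ heq
      have hR₁ : R (w₁, v₁) := by
        by_contra hc
        exact h₁ (if_neg hc)
      have hR₂ : R (w₂, v₂) := by
        by_contra hc
        exact h₂ (if_neg hc)
      have hv₁ := hRbr _ hR₁
      have hv₂ := hRbr _ hR₂
      change w₁ ++ v₁ = w₂ ++ v₂ at heq
      obtain ⟨⟨-, hb₁, hD₁, hbr₁⟩, -, -⟩ := hR₁
      obtain ⟨⟨-, hb₂, hD₂, hbr₂⟩, -, -⟩ := hR₂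
      obtain rfl : w₁ = w₂ :=
        SpanFloor.eq_of_append_eq_of_breaks hD' hb₁ hD₁ hbr₁ hb₂ hD₂ hbr₂ hv₁ hv₂ heq
      obtain rfl : v₁ = v₂ := List.append_cancel_left heq
      rfl
    · intro w hw
      have hc : (IsSAW w ∧ IsBridgeW w ∧ w ≠ [] ∧ ((Finset.range w.length).filter (fun j => IsBreak w j)).card = b) ∧ ((D : ℤ) ≤ xEnd w ∧ xEnd w < 2 * (D : ℤ)) := by
        by_contra hc
        exact hw (if_neg hc)
      obtain ⟨⟨hs, hb, hne, hcount⟩, hDw, hw2D⟩ := hc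
      obtain ⟨w', v, rfl, hsw', hbw', -, hDw', hbrk, hv⟩ := exists_cut hs hb hne hDw
      have hRp : R (w', v) := by
        refine ⟨⟨hsw', hbw', hDw', hbrk⟩, ?_, hDw, hw2D⟩
        rcases hv with hv | ⟨hsv, hbv, hvne, hc'⟩
        · left
          refine ⟨hv, ?_⟩
          rw [hv, List.append_nil] at hcount
          exact hcount
        · right
          exact ⟨hsv, hbv, hvne, hc'.trans hcount⟩
      refine ⟨⟨(w', v), ?_⟩, rfl⟩
      show (if R (w', v) then ENNReal.ofReal (z ^ ((w', v).1 ++ (w', v).2).length * Real.exp (m * (xEnd ((w', v).1 ++ (w', v).2) : ℝ))) else 0) ≠ 0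
      rw [if_pos hRp]
      exact (ENNReal.ofReal_pos.2 (mul_pos (pow_pos hz _) (Real.exp_pos _))).ne'
    · rintro ⟨⟨w', v⟩, h⟩
      have hRp : R (w', v) := by
        by_contra hc
        exact h (if_neg hc)
      show (if (IsSAW (w' ++ v) ∧ IsBridgeW (w' ++ v) ∧ w' ++ v ≠ [] ∧ ((Finset.range (w' ++ v).length).filter (fun j => IsBreak (w' ++ v) j)).card = b) ∧ ((D : ℤ) ≤ xEnd (w' ++ v) ∧ xEnd (w' ++ v) < 2 * (D : ℤ))
        then ENNReal.ofReal (z ^ (w' ++ v).length * Real.exp (m * (xEnd (w' ++ v) : ℝ))) else 0) = if R (w', v) then ENNReal.ofReal (z ^ ((w', v).1 ++ (w', v).2).length * Real.exp (m * (xEnd ((w', v).1 ++ (w', v).2) : ℝ))) else 0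
      rw [if_pos ⟨hRpc _ hRp, hRp.2.2⟩, if_pos hRp]
  -- step 2: termwise, the pair weight is the family weight of the head times the fibre weight
  have step2 : ∀ p : List Step × List Step,
      (if R p then ENNReal.ofReal (z ^ (p.1 ++ p.2).length * Real.exp (m * (xEnd (p.1 ++ p.2) : ℝ))) else 0) ≤ g p.1 * fib p.1 p.2 := by
    rintro ⟨w', v⟩
    by_cases hRp : R (w', v)
    · obtain ⟨⟨hs, hb, hDw, hbrk⟩, hv, -, hwv2D⟩ := id hRp
      dsimp only at hs hb hDw hbrk hv hwv2D
      have hv0 : 0 ≤ xEnd v := (hRbr _ hRp).xEnd_nonneg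
      have hA : IsSAW w' ∧ (IsBridgeW w' ∧ (D : ℤ) ≤ xEnd w' ∧ xEnd w' < 2 * (D : ℤ) ∧
          ∀ j, IsBreak w' j → xAt w' j < (D : ℤ)) := by
        refine ⟨hs, hb, hDw, ?_, hbrk⟩
        rw [xEnd_append] at hwv2D
        linarith
      have hB : (v = [] ∧ ((Finset.range w'.length).filter (fun j => IsBreak w' j)).card = b) ∨ ((IsSAW v ∧ IsBridgeW v ∧ v ≠ [] ∧ ((Finset.range v.length).filter (fun j => IsBreak v j)).card = b - ((Finset.range w'.length).filter (fun j => IsBreak w' j)).card - 1) ∧ ((Finset.range w'.length).filter (fun j => IsBreak w' j)).card < b) := by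
        rcases hv with ⟨hv1, hv2⟩ | ⟨hsv, hbv, hvne, hcount⟩
        · exact Or.inl ⟨hv1, hv2⟩
        · exact Or.inr ⟨⟨hsv, hbv, hvne, by omega⟩, by omega⟩
      show (if R (w', v) then ENNReal.ofReal (z ^ (w' ++ v).length * Real.exp (m * (xEnd (w' ++ v) : ℝ))) else 0) ≤ g w' * fib w' v
      rw [if_pos hRp, hg, hfib]
      dsimp only
      rw [if_pos hA, if_pos hB, twt_append hz0]
    · show (if R (w', v) then ENNReal.ofReal (z ^ (w' ++ v).length * Real.exp (m * (xEnd (w' ++ v) : ℝ))) else 0) ≤ g w' * fib w' v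
      rw [if_neg hRp]
      exact zero_le
  -- step 3: every fibre has mass at most one
  have step3 : ∀ w' : List Step, ∑' v, fib w' v ≤ 1 := by
    intro w'
    rcases lt_trichotomy (((Finset.range w'.length).filter (fun j => IsBreak w' j)).card) b with hlt | heq | hgt
    · rw [← tsum_breaks_twt hz0 h1 (b - ((Finset.range w'.length).filter (fun j => IsBreak w' j)).card - 1)]
      refine ENNReal.tsum_le_tsum fun v => ?_
      rw [hfib]
      dsimp only
      by_cases hv : (IsSAW v ∧ IsBridgeW v ∧ v ≠ [] ∧ ((Finset.range v.length).filter (fun j => IsBreak v j)).card = b - ((Finset.range w'.length).filter (fun j => IsBreak w' j)).card - 1)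
      · rw [if_pos (Or.inr ⟨hv, hlt⟩), if_pos hv]
      · rw [if_neg, if_neg hv]
        rintro (⟨-, h⟩ | ⟨h, -⟩)
        · omega
        · exact hv h
    · have key : ∀ v : List Step, fib w' v = if v = [] then ENNReal.ofReal (z ^ v.length * Real.exp (m * (xEnd v : ℝ))) else 0 := by
        intro v
        rw [hfib]
        dsimp only
        by_cases hv : v = []
        · rw [if_pos (Or.inl ⟨hv, heq⟩), if_pos hv]
        · rw [if_neg, if_neg hv]
          rintro (⟨h, -⟩ | ⟨-, h⟩)
          · exact hv h
          · omega
      rw [tsum_congr key, tsum_eq_single ([] : List Step) (fun v hv => if_neg hv), if_pos rfl, twt_nil]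
    · refine le_of_eq_of_le ?_ zero_le_one
      rw [ENNReal.tsum_eq_zero]
      intro v
      rw [hfib]
      dsimp only
      rw [if_neg]
      rintro (⟨-, h⟩ | ⟨-, h⟩) <;> omega
  -- conclusion
  calc ∑' w, (if (IsSAW w ∧ IsBridgeW w ∧ w ≠ [] ∧ ((Finset.range w.length).filter (fun j => IsBreak w j)).card = b) ∧ ((D : ℤ) ≤ xEnd w ∧ xEnd w < 2 * (D : ℤ)) then ENNReal.ofReal (z ^ w.length * Real.exp (m * (xEnd w : ℝ))) else 0)
      = ∑' p : List Step × List Step, (if R p then ENNReal.ofReal (z ^ (p.1 ++ p.2).length * Real.exp (m * (xEnd (p.1 ++ p.2) : ℝ))) else 0) := step1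
    _ ≤ ∑' p : List Step × List Step, g p.1 * fib p.1 p.2 := ENNReal.tsum_le_tsum step2
    _ = ∑' w', g w' * ∑' v, fib w' v := by
        rw [ENNReal.tsum_prod']
        refine tsum_congr fun w' => ?_
        dsimp only
        rw [ENNReal.tsum_mul_left]
    _ ≤ ∑' w', g w' * 1 := ENNReal.tsum_le_tsum fun w' => mul_le_mul' le_rfl (step3 w')
    _ = ∑' w', g w' := by simp only [mul_one]

end BPD

open BPD in
/-- **Span hyperscaling ⇒ break-point density** (registered sub-goal
`breakPointDensity_of_spanHyperscaling` of the crux item; milestone "S1 + S2 ⇒ anti-lacunarity (A)"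
of the line `subcritical-renewal-floor`, which with `spanRenewalFloor_of_breakPointDensity` gives
`SpanHyperscaling ⇒ SpanRenewalFloor`).  If every exactly tilted pair `(z, m)` with `m ≤ m₀` has
span moments `S₂ ≤ (C/m) S₁`, then for some `c₀ > 0` and every `D ≥ 1` the critical mass of the
bridge words with span in `[D, 2D)` all of whose break points lie below level `D` is `≥ c₀`.  Proof:
module docstring (straight word for `D ≤ D₀`; for `D > D₀`: tilt rate `m = 32 max(C,1)/D`,
Cauchy–Schwarz, Chebyshev on `⌊3D/(2S₁)⌋` i.i.d. irreducible pieces, transfer to `F_D` by the cut at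
the first break point at level `≥ D`, un-tilting). [cite: Kesten1963SAW, §4] -/
theorem breakPointDensity_of_spanHyperscaling :
    (∃ C m₀ : ℝ, 0 < m₀ ∧ ∀ z m : ℝ, 0 < z → z ≤ criticalFugacity → 0 < m → m ≤ m₀ → HasSum (fun n : ℕ => ∑ w ∈ (sawWords n).filter (fun w => IsIrrBridge w), z ^ w.length * Real.exp (m * (xEnd w : ℝ))) 1 → ∃ S₁ S₂ : ℝ, HasSum (fun n : ℕ => ∑ w ∈ (sawWords n).filter (fun w => IsIrrBridge w), (xEnd w : ℝ) * (z ^ w.length * Real.exp (m * (xEnd w : ℝ)))) S₁ ∧ HasSum (fun n : ℕ => ∑ w ∈ (sawWords n).filter (fun w => IsIrrBridge w), (xEnd w : ℝ) ^ 2 * (z ^ w.length * Real.exp (m * (xEnd w : ℝ)))) S₂ ∧ S₂ ≤ C / m * S₁) → ∃ c₀ : ℝ, 0 < c₀ ∧ ∀ D : ℕ, 1 ≤ D → ∃ N : ℕ, c₀ ≤ ∑ n ∈ Finset.range (N + 1), ∑ _w ∈ (sawWords n).filter (fun w => IsBridgeW w ∧ (D : ℤ) ≤ xEnd w ∧ xEnd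 w < 2 * (D : ℤ) ∧ ∀ j, IsBreak w j → xAt w j < (D : ℤ)), criticalFugacity ^ n := by
  rintro ⟨C, m₀, hm₀, hyp⟩
  obtain ⟨m₁, hm₁, tilt⟩ := stub_kestenTilt
  have hxc : 0 < criticalFugacity := StripMass.criticalFugacity_pos
  have hxc1 : criticalFugacity ≤ 1 := by
    have h := Zd.one_le_connectiveConstant 2
    rw [Zd.connectiveConstant_two] at h
    exact inv_le_one_of_one_le₀ h
  -- constants
  set C' : ℝ := max C 1 with hC'
  have hC'1 : 1 ≤ C' := le_max_right _ _
  have hCC' : C ≤ C' := le_max_left _ _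
  set r : ℝ := 32 * C' with hr
  have hr0 : 0 < r := by positivity
  set ms : ℝ := min m₀ m₁ with hms
  have hms0 : 0 < ms := lt_min hm₀ hm₁
  set D₀ : ℕ := ⌈r / ms⌉₊ with hD₀
  refine ⟨min (criticalFugacity ^ D₀) (Real.exp (-(2 * r)) / 4), lt_min (pow_pos hxc _) (by positivity),
    fun D hD => ?_⟩
  rcases le_or_gt D D₀ with hDle | hDgt
  · -- small scales: the straight word `E^D ∈ F_D` weighs `x_c^D ≥ x_c^{D₀}`
    refine ⟨D, (min_le_left _ _).trans ((pow_le_pow_of_le_one hxc.le hxc1 hDle).trans ?_)⟩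
    calc criticalFugacity ^ D ≤ ∑ _w ∈ (sawWords D).filter (fun w => IsBridgeW w ∧ (D : ℤ) ≤ xEnd w ∧
          xEnd w < 2 * (D : ℤ) ∧ ∀ j, IsBreak w j → xAt w j < (D : ℤ)), criticalFugacity ^ D :=
          Finset.single_le_sum (f := fun _ => criticalFugacity ^ D) (fun _ _ => pow_nonneg hxc.le _)
            (straight_mem hD)
      _ ≤ _ := Finset.single_le_sum (f := fun n => ∑ _w ∈ (sawWords n).filter (fun w => IsBridgeW w ∧
            (D : ℤ) ≤ xEnd w ∧ xEnd w < 2 * (D : ℤ) ∧ ∀ j, IsBreak w j → xAt w j < (D : ℤ)),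
              criticalFugacity ^ n) (fun _ _ => Finset.sum_nonneg fun _ _ => pow_nonneg hxc.le _)
            (Finset.mem_range.2 (Nat.lt_succ_self D))
  · -- large scales
    have hD0 : (0 : ℝ) < D := by exact_mod_cast (show 0 < D by omega)
    have hD1 : (1 : ℝ) ≤ D := by exact_mod_cast hD
    -- the tilt rate `m = r / D ≤ min m₀ m₁`
    set m : ℝ := r / D with hm
    have hm0 : 0 < m := div_pos hr0 hD0
    have hmle : m ≤ ms := by
      rw [hm, div_le_iff₀ hD0]
      have h1 : r / ms ≤ D₀ := Nat.le_ceil _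
      have h2 : (D₀ : ℝ) ≤ D := by exact_mod_cast hDgt.le
      have h3 : r / ms * ms = r := by field_simp
      nlinarith [h1.trans h2]
    obtain ⟨z, -, hz, hzc, h1⟩ := tilt m hm0 (hmle.trans (min_le_right _ _))
    obtain ⟨S₁, S₂, hS₁, hS₂, hhyp⟩ := hyp z m hz hzc hm0 (hmle.trans (min_le_left _ _)) h1
    -- real facts: `1 ≤ S₁`, `0 ≤ S₂ ≤ (C' D / r) S₁ = (D/32) S₁`
    have hS₁1 : 1 ≤ S₁ := by
      refine hasSum_le (fun n => Finset.sum_le_sum fun w hw => ?_) h1 hS₁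
      have hw := (Finset.mem_filter.1 hw).2
      have hx : (1 : ℝ) ≤ (xEnd w : ℝ) := by
        exact_mod_cast StripMass.one_le_xEnd_of_ne_nil hw.bridge hw.ne_nil
      exact le_mul_of_one_le_left (KestenTilt.tiltWt_nonneg hz.le m w) hx
    have hS₁0 : 0 ≤ S₁ := zero_le_one.trans hS₁1
    have hS₂0 : 0 ≤ S₂ := hS₂.nonneg fun n => Finset.sum_nonneg fun w _ =>
      mul_nonneg (sq_nonneg _) (KestenTilt.tiltWt_nonneg hz.le m w)
    have hCDr : C' * D / r = D / 32 := by rw [hr]; field_simp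
    have hS₂le : S₂ ≤ D / 32 * S₁ := by
      refine hhyp.trans ?_
      rw [← hCDr]
      refine mul_le_mul_of_nonneg_right ?_ hS₁0
      rw [hm, div_div_eq_mul_div]
      exact div_le_div_of_nonneg_right (by nlinarith) hr0.le
    -- the three tilted functionals as sums over words in `ℝ≥0∞`
    have e1 : ∑' w, (if IsIrrBridge w then ENNReal.ofReal (z ^ w.length * Real.exp (m * (xEnd w : ℝ))) else 0) = 1 := by
      have h := tsum_irr_of_hasSum hz.le (m := m) (F := fun _ => (1 : ℝ)) (fun _ _ => zero_le_one)
        (S := 1) (by simpa only [one_mul] using h1)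
      simpa only [ENNReal.ofReal_one, one_mul] using h
    have eS₁ : ∑' w, (if IsIrrBridge w then ENNReal.ofReal (xEnd w : ℝ) * ENNReal.ofReal (z ^ w.length * Real.exp (m * (xEnd w : ℝ))) else 0) = ENNReal.ofReal S₁ :=
      tsum_irr_of_hasSum hz.le (F := fun w => (xEnd w : ℝ))
        (fun w hw => by exact_mod_cast hw.bridge.xEnd_nonneg) hS₁
    have eS₂ : ∑' w, (if IsIrrBridge w then ENNReal.ofReal (xEnd w : ℝ) ^ 2 * ENNReal.ofReal (z ^ w.length * Real.exp (m * (xEnd w : ℝ))) else 0) = ENNReal.ofReal S₂ := by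
      have h := tsum_irr_of_hasSum hz.le (F := fun w => (xEnd w : ℝ) ^ 2) (fun w _ => sq_nonneg _) hS₂
      refine Eq.trans (tsum_congr fun w => ?_) h
      split_ifs with hw
      · rw [ENNReal.ofReal_pow (by exact_mod_cast hw.bridge.xEnd_nonneg)]
      · rfl
    -- Cauchy–Schwarz: `S₁ ≤ D / 32`
    have hCS : S₁ ^ 2 ≤ S₂ := sq_le_of_tsums hz.le hS₁0 hS₂0 e1 eS₁ eS₂
    have hS₁pos : 0 < S₁ := by linarith
    have hS₁le : S₁ ≤ D / 32 := by
      have h : S₁ * S₁ ≤ D / 32 * S₁ := by rw [← sq]; exact hCS.trans hS₂le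
      exact le_of_mul_le_mul_right h hS₁pos
    -- the number of pieces `n = ⌊(3D/2)/S₁⌋ ≥ 1`
    set n : ℕ := ⌊3 * (D : ℝ) / 2 / S₁⌋₊ with hn
    have hn1 : (n : ℝ) * S₁ ≤ 3 * D / 2 := by
      have h := Nat.floor_le (show 0 ≤ 3 * (D : ℝ) / 2 / S₁ by positivity)
      rwa [← hn, le_div_iff₀ hS₁pos] at h
    have hn2 : 3 * (D : ℝ) / 2 - S₁ < n * S₁ := by
      have h := Nat.lt_floor_add_one (3 * (D : ℝ) / 2 / S₁)
      rw [← hn, div_lt_iff₀ hS₁pos] at h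
      linarith
    have hnpos : 1 ≤ n := by
      rw [hn]
      refine Nat.le_floor ?_
      rw [Nat.cast_one, le_div_iff₀ hS₁pos]
      linarith
    obtain ⟨b, hb⟩ : ∃ b : ℕ, n = b + 1 := ⟨n - 1, by omega⟩
    have hbn : ((b : ℝ) + 1) = n := by rw [hb]; push_cast; ring
    -- Chebyshev with `t = 3D/8`: the tail has tilted mass `≤ n S₂ / t² ≤ 1/3`
    set t : ℝ := 3 * D / 8 with ht
    have ht0 : 0 < t := by positivity
    have hbad := tsum_tail_le hz.le hS₁0 hS₂0 e1 eS₁ eS₂ b ht0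
    rw [hbn] at hbad
    have hratio : (n : ℝ) * S₂ / t ^ 2 ≤ 1 / 3 := by
      rw [div_le_iff₀ (by positivity), ht]
      have h1 : (n : ℝ) * S₂ ≤ n * (D / 32 * S₁) := mul_le_mul_of_nonneg_left hS₂le (Nat.cast_nonneg n)
      nlinarith [hn1, hD0]
    have hgood := tsum_good_add_tsum_tail z m b ((n : ℝ) * S₁) t
    rw [tsum_breaks_twt hz.le e1 b] at hgood
    -- the good event has tilted mass `≥ 1 - 1/3 ≥ 1/2`
    have hPgood : ENNReal.ofReal (1 / 2) ≤
        ∑' w, (if (IsSAW w ∧ IsBridgeW w ∧ w ≠ [] ∧ ((Finset.range w.length).filter (fun j => IsBreak w j)).card = b) ∧ |(xEnd w : ℝ) - n * S₁| < t then ENNReal.ofReal (z ^ w.length * Real.exp (m * (xEnd w : ℝ))) else 0) := by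
      have hb' : ∑' w, (if (IsSAW w ∧ IsBridgeW w ∧ w ≠ [] ∧ ((Finset.range w.length).filter (fun j => IsBreak w j)).card = b) ∧ t ≤ |(xEnd w : ℝ) - n * S₁| then ENNReal.ofReal (z ^ w.length * Real.exp (m * (xEnd w : ℝ))) else 0)
          ≤ ENNReal.ofReal (1 / 3) := hbad.trans (ENNReal.ofReal_le_ofReal hratio)
      have h : (1 : ℝ≥0∞) ≤ ∑' w, (if (IsSAW w ∧ IsBridgeW w ∧ w ≠ [] ∧ ((Finset.range w.length).filter (fun j => IsBreak w j)).card = b) ∧ |(xEnd w : ℝ) - n * S₁| < t then ENNReal.ofReal (z ^ w.length * Real.exp (m * (xEnd w : ℝ))) else 0)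
          + ENNReal.ofReal (1 / 3) := hgood.symm.le.trans (add_le_add le_rfl hb')
      calc ENNReal.ofReal (1 / 2) ≤ ENNReal.ofReal (1 - 1 / 3) := ENNReal.ofReal_le_ofReal (by norm_num)
        _ = 1 - ENNReal.ofReal (1 / 3) := by
            rw [ENNReal.ofReal_sub _ (by norm_num : (0 : ℝ) ≤ 1 / 3), ENNReal.ofReal_one]
        _ ≤ _ := tsub_le_iff_right.2 h
    -- the good event lies in the window `[D, 2D)`
    have hwin : ∑' w, (if (IsSAW w ∧ IsBridgeW w ∧ w ≠ [] ∧ ((Finset.range w.length).filter (fun j => IsBreak w j)).card = b) ∧ |(xEnd w : ℝ) - n * S₁| < t then ENNReal.ofReal (z ^ w.length * Real.exp (m * (xEnd w : ℝ))) else 0)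
        ≤ ∑' w, (if (IsSAW w ∧ IsBridgeW w ∧ w ≠ [] ∧ ((Finset.range w.length).filter (fun j => IsBreak w j)).card = b) ∧ ((D : ℤ) ≤ xEnd w ∧ xEnd w < 2 * (D : ℤ)) then ENNReal.ofReal (z ^ w.length * Real.exp (m * (xEnd w : ℝ))) else 0) := by
      refine ENNReal.tsum_le_tsum fun w => ?_
      by_cases hw : (IsSAW w ∧ IsBridgeW w ∧ w ≠ [] ∧ ((Finset.range w.length).filter (fun j => IsBreak w j)).card = b) ∧ |(xEnd w : ℝ) - n * S₁| < t
      · obtain ⟨hlo, hhi⟩ := abs_lt.1 hw.2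
        have hx1 : (D : ℝ) ≤ (xEnd w : ℝ) := by linarith
        have hx2 : (xEnd w : ℝ) < 2 * (D : ℝ) := by linarith
        have hx1' : (D : ℤ) ≤ xEnd w := by exact_mod_cast hx1
        have hx2' : xEnd w < 2 * (D : ℤ) := by exact_mod_cast hx2
        rw [if_pos hw, if_pos ⟨hw.1, hx1', hx2'⟩]
      · rw [if_neg hw]
        exact zero_le
    -- transfer to `F_D` and un-tilt
    have hfd := tsum_window_le_tsum_fd hz e1 b hD
    have huntilt := tsum_fd_twt_le hz.le hzc hm0.le D
    have hexp : Real.exp (m * (2 * (D : ℝ))) = Real.exp (2 * r) := by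
      congr 1; rw [hm]; field_simp
    rw [hexp] at huntilt
    have hpos : 0 < Real.exp (2 * r) := Real.exp_pos _
    have hT : ENNReal.ofReal (Real.exp (-(2 * r)) / 4) <
        ∑' w, (if IsSAW w ∧ (IsBridgeW w ∧ (D : ℤ) ≤ xEnd w ∧ xEnd w < 2 * (D : ℤ) ∧
          ∀ j, IsBreak w j → xAt w j < (D : ℤ)) then ENNReal.ofReal (criticalFugacity ^ w.length)
          else 0) := by
      have hle := hPgood.trans (hwin.trans (hfd.trans huntilt))
      rw [mul_comm] at hle
      rw [← ENNReal.div_le_iff_le_mul (Or.inl (ENNReal.ofReal_pos.2 hpos).ne')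
        (Or.inl ENNReal.ofReal_ne_top), ← ENNReal.ofReal_div_of_pos hpos] at hle
      refine lt_of_lt_of_le ((ENNReal.ofReal_lt_ofReal_iff (by positivity)).2 ?_) hle
      rw [lt_div_iff₀ hpos, Real.exp_neg, div_mul_eq_mul_div, inv_mul_cancel₀ hpos.ne']
      norm_num
    obtain ⟨N, hN⟩ := exists_partialSum_gt (fun w => IsBridgeW w ∧ (D : ℤ) ≤ xEnd w ∧
      xEnd w < 2 * (D : ℤ) ∧ ∀ j, IsBreak w j → xAt w j < (D : ℤ)) (by positivity) hT
    exact ⟨N, (min_le_right _ _).trans hN.le⟩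

end Summit.CriticalPhenomena.SAWScalingLimit.Theorems.TubeLowerBound.SubcriticalRenewalFloor

end
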